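import Literature.AlgebraicGeometry.Motives.ProjectiveOfGeneratingSections
import Literature.AlgebraicGeometry.Motives.SmoothHypersurfaceScheme
import Literature.AlgebraicGeometry.Motives.FermatHypersurface
import HarnessLib

/-!
# The equation of a hypersurface on the standard charts

Topic `Literature/AlgebraicGeometry/Motives`; theorem-only. For the reduced hypersurface
`X_F = V₊(F) ⊂ ℙⁿ⁺¹_k` (`SmoothHypersurface.hypersurface F`, `F` a nonsingular form of degree
`d > 0`) with its closed immersion `ι : X_F ↪ ℙⁿ⁺¹`, and the generating sections
`GeneratingSections.ofHom ι` (opens `ι⁻¹D₊(x_a)`, ratios `ι^*(x_c/x_a)`): the dehomogenised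
equation holds on each chart, `F(ι^*(x_c/x_a))_c = 0` in `Γ(X_F, ι⁻¹D₊(x_a))` — because the section
`F/x_aᵈ` of `ℙⁿ⁺¹` over `D₊(x_a)` is invertible exactly on `D₊(x_a F)`, which misses `V₊(F)`, and
`X_F` is reduced. For the Fermat form: `Σ_c ι^*(x_c/x_a)ᵐ = 0`.

## References

* R. Hartshorne, *Algebraic Geometry* (1977), I Ex. 5.8 (b), II Example 3.2.6 and Prop. 2.5 (b).
  [Hartshorne1977]
-/

noncomputable section

universe u

open CategoryTheory AlgebraicGeometry HomogeneousLocalization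
open MvPolynomial (X C eval₂Hom)
open Literature.AlgebraicGeometry.Motives.Segre

namespace Literature.AlgebraicGeometry.Motives

namespace SmoothHypersurface

attribute [local instance] MvPolynomial.gradedAlgebra

variable {k : Type u} [Field k] {n : ℕ} (F : MvPolynomial (Fin (n + 2)) k) {d : ℕ}

/-- `F ∈ k[x]_{d • 1}` for `F` homogeneous of degree `d`. [folklore] -/
theorem mem_grading_smul_one (hF : F.IsHomogeneous d) : F ∈ grading (Fin (n + 2)) k (d • 1) := by
  rw [smul_eq_mul, mul_one]
  exact (MvPolynomial.mem_homogeneousSubmodule d F).mpr hF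

/-- **The section `F/x_aᵈ` dies on `X_F`**: its pull-back along the chart map
`X_F ∩ D₊(x_a) → D₊(x_a) = Spec (k[x]_{(x_a)})₀` vanishes (`X_F` reduced and the basic open of the
pull-back, `X_F ∩ D₊(x_a F)`, is empty). [cite: Hartshorne1977, II Example 3.2.6] -/
theorem pull_chartLift_awayMk_eq_zero (hF : F.IsHomogeneous d) (hJ : IsNonsingularForm k F) (hd : 0 < d)
    (a : Fin (n + 2)) :
    pull (GeneratingSections.chartLift (hypersurfaceι F).left a)
      (Away.mk (grading (Fin (n + 2)) k) (X_mem k a) d F (mem_grading_smul_one F hF)) = 0 := by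
  haveI : IsReduced (hypersurface F).left := isReduced_hypersurface F hF hJ hd
  set r := (hypersurfaceι F).left with hr
  haveI : IsReduced (↑(GeneratingSections.preU r a) : Scheme.{u}) :=
    isReduced_of_isOpenImmersion (GeneratingSections.preU r a).ι
  rw [← basicOpen_eq_bot_iff, basicOpen_pull]
  -- `F/x_aᵈ`, up to `F = F ^ 1`, is Mathlib's `isLocalizationElem`
  have hmk : Away.mk (grading (Fin (n + 2)) k) (X_mem k a) d F (mem_grading_smul_one F hF) =
      Away.isLocalizationElem (X_mem k a) ((MvPolynomial.mem_homogeneousSubmodule d F).mpr hF) := by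
    apply HomogeneousLocalization.val_injective
    simp only [Away.val_mk, pow_one]
  rw [hmk, ← Proj.awayι_preimage_basicOpen _ (X_mem k a) zero_lt_one
    ((MvPolynomial.mem_homogeneousSubmodule d F).mpr hF) hd, ← Scheme.Hom.comp_preimage,
    GeneratingSections.chartLift_chartι]
  ext x
  simp only [TopologicalSpace.Opens.coe_bot, Set.mem_empty_iff_false, iff_false]
  intro hx
  have hmem : ((GeneratingSections.preU r a).ι ≫ r) x ∈
      ProjectiveSpectrum.zeroLocus (grading (Fin (n + 2)) k) {F} := by
    rw [← range_hypersurfaceι F]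
    exact ⟨_, (Scheme.Hom.comp_apply _ _ x).symm⟩
  exact (show F ∉ _ from hx) (hmem (Set.mem_singleton F))

/-- **The dehomogenised equation on the chart**: `F`, evaluated at the ratios `ι^*(x_c/x_a)` (with
coefficients through `k → Γ(X_F, ι⁻¹D₊(x_a))`), vanishes. [cite: Hartshorne1977, I Ex. 5.8 (b)] -/
theorem eval₂_homRatio_eq_zero (hF : F.IsHomogeneous d) (hJ : IsNonsingularForm k F) (hd : 0 < d)
    (a : Fin (n + 2)) :
    eval₂Hom ((((GeneratingSections.preU (hypersurfaceι F).left a).topIso.hom.hom.comp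
        (pull (GeneratingSections.chartLift (hypersurfaceι F).left a))).comp (cst k (X a))))
      (GeneratingSections.homRatio (hypersurfaceι F).left a) F = 0 := by
  have h := congrArg ((GeneratingSections.preU (hypersurfaceι F).left a).topIso.hom.hom.comp
    (pull (GeneratingSections.chartLift (hypersurfaceι F).left a)))
    (awayMk_eq_eval₂ k a d F (mem_grading_smul_one F hF))
  rw [MvPolynomial.map_eval₂Hom] at h
  rw [RingHom.comp_apply, pull_chartLift_awayMk_eq_zero F hF hJ hd a, map_zero] at h
  exact h.symm

/-- **The Fermat equation on the chart**: `Σ_c ι^*(x_c/x_a)ᵐ = 0` in `Γ(Xⁿₘ, ι⁻¹D₊(x_a))`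
(`m ≥ 1`, `m ≠ 0` in `k`). [cite: Hartshorne1977, I Ex. 5.8 (b)] -/
theorem sum_homRatio_pow_fermat_eq_zero {m : ℕ} (hm : 1 ≤ m) (hmk : (m : k) ≠ 0) (a : Fin (n + 2)) :
    ∑ c, GeneratingSections.homRatio (hypersurfaceι (fermatPolynomial k n m)).left a c ^ m = 0 := by
  have h := eval₂_homRatio_eq_zero (fermatPolynomial k n m) (isHomogeneous_fermatPolynomial n m)
    (isNonsingularForm_sum_X_pow hmk) hm a
  have key : ∀ (S : Type u) [CommRing S] (φ : k →+* S) (g : Fin (n + 2) → S),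
      eval₂Hom φ g (fermatPolynomial k n m) = ∑ c, g c ^ m := fun S _ φ g ↦ by
    simp [fermatPolynomial]
  rwa [key] at h

/-! ## The same for any morphism into `V₊(F)` from a reduced scheme -/

/-- **`F/x_aᵈ` dies along any morphism `r : Y → ℙⁿ⁺¹` from a reduced scheme with image in
`V₊(F)`** (e.g. `Y → X_F ↪ ℙⁿ⁺¹`). [cite: Hartshorne1977, II Example 3.2.6] -/
theorem pull_chartLift_awayMk_eq_zero_of_range_subset (hF : F.IsHomogeneous d) (hd : 0 < d)
    {Y : Scheme.{u}} [IsReduced Y] (r : Y ⟶ Proj (grading (Fin (n + 2)) k))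
    (hr : Set.range r ⊆ ProjectiveSpectrum.zeroLocus (grading (Fin (n + 2)) k) {F})
    (a : Fin (n + 2)) :
    pull (GeneratingSections.chartLift r a)
      (Away.mk (grading (Fin (n + 2)) k) (X_mem k a) d F (mem_grading_smul_one F hF)) = 0 := by
  haveI : IsReduced (↑(GeneratingSections.preU r a) : Scheme.{u}) :=
    isReduced_of_isOpenImmersion (GeneratingSections.preU r a).ι
  rw [← basicOpen_eq_bot_iff, basicOpen_pull]
  have hmk : Away.mk (grading (Fin (n + 2)) k) (X_mem k a) d F (mem_grading_smul_one F hF) =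
      Away.isLocalizationElem (X_mem k a) ((MvPolynomial.mem_homogeneousSubmodule d F).mpr hF) := by
    apply HomogeneousLocalization.val_injective
    simp only [Away.val_mk, pow_one]
  rw [hmk, ← Proj.awayι_preimage_basicOpen _ (X_mem k a) zero_lt_one
    ((MvPolynomial.mem_homogeneousSubmodule d F).mpr hF) hd, ← Scheme.Hom.comp_preimage,
    GeneratingSections.chartLift_chartι]
  ext x
  simp only [TopologicalSpace.Opens.coe_bot, Set.mem_empty_iff_false, iff_false]
  intro hx
  have hmem : ((GeneratingSections.preU r a).ι ≫ r) x ∈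
      ProjectiveSpectrum.zeroLocus (grading (Fin (n + 2)) k) {F} :=
    hr ⟨_, (Scheme.Hom.comp_apply _ _ x).symm⟩
  exact (show F ∉ _ from hx) (hmem (Set.mem_singleton F))

/-- **The dehomogenised equation along any morphism into `V₊(F)` from a reduced scheme.**
[cite: Hartshorne1977, I Ex. 5.8 (b)] -/
theorem eval₂_homRatio_eq_zero_of_range_subset (hF : F.IsHomogeneous d) (hd : 0 < d)
    {Y : Scheme.{u}} [IsReduced Y] (r : Y ⟶ Proj (grading (Fin (n + 2)) k))
    (hr : Set.range r ⊆ ProjectiveSpectrum.zeroLocus (grading (Fin (n + 2)) k) {F})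
    (a : Fin (n + 2)) :
    eval₂Hom ((((GeneratingSections.preU r a).topIso.hom.hom.comp
        (pull (GeneratingSections.chartLift r a))).comp (cst k (X a))))
      (GeneratingSections.homRatio r a) F = 0 := by
  have h := congrArg ((GeneratingSections.preU r a).topIso.hom.hom.comp
    (pull (GeneratingSections.chartLift r a))) (awayMk_eq_eval₂ k a d F (mem_grading_smul_one F hF))
  rw [MvPolynomial.map_eval₂Hom] at h
  rw [RingHom.comp_apply, pull_chartLift_awayMk_eq_zero_of_range_subset F hF hd r hr a,
    map_zero] at h
  exact h.symm

/-- **The Fermat equation along any morphism into `V₊(x₀ᵐ + ⋯ + x_{n+1}ᵐ)` from a reduced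
scheme**: `Σ_c r^*(x_c/x_a)ᵐ = 0`. [cite: Hartshorne1977, I Ex. 5.8 (b)] -/
theorem sum_homRatio_pow_eq_zero_of_range_subset {m : ℕ} (hm : 1 ≤ m)
    {Y : Scheme.{u}} [IsReduced Y] (r : Y ⟶ Proj (grading (Fin (n + 2)) k))
    (hr : Set.range r ⊆
      ProjectiveSpectrum.zeroLocus (grading (Fin (n + 2)) k) {fermatPolynomial k n m})
    (a : Fin (n + 2)) :
    ∑ c, GeneratingSections.homRatio r a c ^ m = 0 := by
  have h := eval₂_homRatio_eq_zero_of_range_subset (fermatPolynomial k n m)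
    (isHomogeneous_fermatPolynomial n m) hm r hr a
  have key : ∀ (S : Type u) [CommRing S] (φ : k →+* S) (g : Fin (n + 2) → S),
      eval₂Hom φ g (fermatPolynomial k n m) = ∑ c, g c ^ m := fun S _ φ g ↦ by
    simp [fermatPolynomial]
  rwa [key] at h

end SmoothHypersurface

end Literature.AlgebraicGeometry.Motives

end
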